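import Literature.AlgebraicGeometry.Resolution.RestrictionPropertyCartier
import Literature.AlgebraicGeometry.Resolution.StrictNormalCrossingsFibre
import Literature.AlgebraicGeometry.Resolution.EffectiveCartierStalks
import HarnessLib

/-!
# `PatchingRelPerfect` (stmt-ResolutionOfSingularities-16161), chain W5.2 — rung R5ᴴ, N1 tools: restricting effective Cartier
# divisors to each other, and the restriction property of blow-ups with an exponent

[OURS · L1 W5.2 · res-D-pv-055, owner of R5ᴴ; tools for N1 `hLedInitial`] Two scheme-theoretic lemmas used to build the initial
hypersurface-led package (`…DepthHLedInitial`), where the carrier `W = V(𝓗)` is the strict transform `𝓗 = ((f)𝒪 : 𝓘_Eᵈ)` of the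
hypersurface `V(f) ⊂ Spec S` on `X = Bl_𝔪 Spec S`:

* `isEffectiveCartier_comap_subschemeι_swap` — for effective Cartier divisors `I`, `P` on a locally Noetherian scheme, if `P|_{V(I)}`
  is an effective Cartier divisor then so is `I|_{V(P)}` (stalkwise: `t` a non-zero-divisor, `F` a non-zero-divisor modulo `t`
  ⇒ `t` a non-zero-divisor modulo `F`, by `a t = c F ⇒ c ∈ (t) ⇒ a ∈ (F)`); used with `I = 𝓘_E`, `P = 𝓗`, where `𝓗|_E = 𝓟(P₀)` is
  a non-zero locally principal ideal of the integral `E ≅ ℙ³`;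
* `IsBlowup.isBlowup_subscheme_of_pow_mul_eq` — the formal half of the restriction property of blow-ups (BGMW 2011 §4 Remark (3);
  tree `IsBlowup.isBlowup_subscheme_controlledTransform_of_isEffectiveCartier`, exponent `1`) for an ARBITRARY exponent `μ` and an
  arbitrary closed immersion `k : Y ⟶ X` as the model of the subscheme: if `π : X' → X` is a blow-up along `C`,
  `(C𝒪_{X'})^μ · Q = π^*(ker k)` and `C𝒪_{X'}` restricts to an effective Cartier divisor on `V(Q)`, then every morphism
  `V(Q) → Y` over `π` is a blow-up of `Y` along `C|_Y`; used with `Y = Spec (S ⧸ (f))`, `μ = d = ord_𝔪 f`, `Q = 𝓗`, which makes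
  `W` integral of dimension three (`IsBlowup.isIntegral`, `IsBirational.topologicalKrullDim_eq_of_isProper`).

Honest framing: OURS (AI-written, weaker than expert review); corollaries of tree theorems; nothing here is a statement of the
manuscript under review.

## Sources
* E. Bierstone, D. Grigoriev, P. Milman, J. Włodarczyk (2011), §4 Remark (3), Lemma 3.6.4 (6). [BierstoneGrigorievMilmanWlodarczyk2011]
* U. Görtz, T. Wedhorn, *Algebraic Geometry I* (2020), Prop. 13.91 (1), Prop. 13.96 (2). [GortzWedhorn2020]
* The Stacks Project, Tag 01WS, Tag 056P. [StacksProject]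
-/

set_option linter.dupNamespace false -- mandated namespace of this single-conjunct summit

noncomputable section

open CategoryTheory AlgebraicGeometry TopologicalSpace IsLocalRing
open Literature.AlgebraicGeometry.Resolution Scheme.IdealSheafData

namespace Summit.ResolutionOfSingularities.ResolutionOfSingularities.Theorems.DepthTargets

universe u

/-- **Restricting two effective Cartier divisors to each other.** On a locally Noetherian scheme let `I`, `P` be effective
Cartier divisors such that `P|_{V(I)}` is an effective Cartier divisor; then `I|_{V(P)}` is an effective Cartier divisor.
(At a point `x ∈ V(I) ∩ V(P)` with `I_x = (t)`, `P_x = (F)`: `F` is a non-zero-divisor modulo `t`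
(`mk_mem_nonZeroDivisors_of_isEffectiveCartier_comap_subschemeι`); if `a t = c F` then `c F ∈ (t)`, so `c = c' t`, so
`t (a - c' F) = 0` and `a = c' F` as `t` is a non-zero-divisor — `t` is a non-zero-divisor modulo `F`; conclude by Stacks 01WS,
`isEffectiveCartier_of_forall_mem_nonZeroDivisors`.) [cite: StacksProject, Tag 01WS] [cite: StacksProject, Tag 056P] -/
theorem isEffectiveCartier_comap_subschemeι_swap {X : Scheme.{u}} [IsLocallyNoetherian X] {I P : X.IdealSheafData}
    (hI : IsEffectiveCartier I) (hP : IsEffectiveCartier P) (h : IsEffectiveCartier (P.comap I.subschemeι)) :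
    IsEffectiveCartier (I.comap P.subschemeι) := by
  haveI : IsLocallyNoetherian P.subscheme := LocallyOfFiniteType.isLocallyNoetherian P.subschemeι
  refine isEffectiveCartier_of_forall_mem_nonZeroDivisors fun z hz => ?_
  have hxI : P.subschemeι.base z ∈ (I.support : Set X) := by
    rw [support_comap] at hz
    exact hz
  obtain ⟨t, ht, htgen⟩ := hI.exists_stalkIdeal_eq_span (P.subschemeι.base z)
  obtain ⟨F, -, hFgen⟩ := hP.exists_stalkIdeal_eq_span (P.subschemeι.base z)
  -- `F` is a non-zero-divisor modulo `t`
  have hFt := mk_mem_nonZeroDivisors_of_isEffectiveCartier_comap_subschemeι h hxI hFgen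
  set φ := (P.subschemeι.stalkMap z).hom with hφ
  have hsurj : Function.Surjective φ := P.subschemeι.stalkMap_surjective z
  have hker : RingHom.ker φ = stalkIdeal P (P.subschemeι.base z) := ker_stalkMap_subschemeι P z
  refine ⟨φ t, ?_, ?_⟩
  · rw [mem_nonZeroDivisors_iff_right]
    intro y hy
    obtain ⟨a, rfl⟩ := hsurj y
    have hat : a * t ∈ RingHom.ker φ := by
      rw [RingHom.mem_ker, map_mul]
      exact hy
    rw [hker, hFgen, Ideal.mem_span_singleton'] at hat
    obtain ⟨c, hc⟩ := hat
    -- `c ∈ (t)`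
    have hcF : Ideal.Quotient.mk (stalkIdeal I (P.subschemeι.base z)) c *
        Ideal.Quotient.mk (stalkIdeal I (P.subschemeι.base z)) F = 0 := by
      rw [← map_mul, hc, Ideal.Quotient.eq_zero_iff_mem, htgen]
      exact Ideal.mul_mem_left _ _ (Ideal.mem_span_singleton_self t)
    have hc0 : Ideal.Quotient.mk (stalkIdeal I (P.subschemeι.base z)) c = 0 :=
      (mem_nonZeroDivisors_iff_right.mp hFt) _ hcF
    rw [Ideal.Quotient.eq_zero_iff_mem, htgen, Ideal.mem_span_singleton'] at hc0
    obtain ⟨c', rfl⟩ := hc0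
    -- `a = c' F` since `t` is a non-zero-divisor
    have hat' : (a - c' * F) * t = 0 := by
      rw [sub_mul, mul_assoc, mul_comm F t, ← mul_assoc, hc, sub_self]
    have ha : a = c' * F := sub_eq_zero.mp ((mem_nonZeroDivisors_iff_right.mp ht) _ hat')
    rw [ha, ← RingHom.mem_ker, hker, hFgen]
    exact Ideal.mul_mem_left _ _ (Ideal.mem_span_singleton_self F)
  · rw [stalkIdeal_comap_eq_map_stalkMap, htgen, Ideal.map_span, Set.image_singleton]

/-- **The restriction property of blow-ups, formal half, with an exponent.** Let `π : X' → X` be a blow-up along `C` (`X` locally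
Noetherian), `k : Y ⟶ X` a closed immersion, `Q` an ideal sheaf on `X'` with `(C𝒪_{X'})^μ · Q = π^*(ker k)` (e.g. the controlled
transform `Q = (π^*(ker k) : (C𝒪)^μ)` when `ker k ≤ C^μ`), and suppose `C𝒪_{X'}` restricts to an effective Cartier divisor on `V(Q)`.
Then every morphism `πS : V(Q) → Y` over `π` is a blow-up of `Y` along `C|_Y`. (Universality: a morphism `f : W → Y` making `C|_Y`
Cartier lifts to `g : W → X'`; `g` lands in `V(Q)` because `g^*(C𝒪)^μ · g^*Q = f^* k^*(ker k) = 0` with `g^*(C𝒪)^μ` an effective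
Cartier divisor; uniqueness from that of `g`.) [cite: BierstoneGrigorievMilmanWlodarczyk2011, §4 Remark (3)]
[cite: GortzWedhorn2020, Prop. 13.91 (1)] -/
theorem IsBlowup.isBlowup_subscheme_of_pow_mul_eq {X X' Y : Scheme.{u}} [IsLocallyNoetherian X] {π : X' ⟶ X}
    {C : X.IdealSheafData} (hπ : IsBlowup π C) (k : Y ⟶ X) [IsClosedImmersion k] {Q : X'.IdealSheafData} {μ : ℕ}
    (hQ : C.comap π ^ μ * Q = k.ker.comap π) (hE : IsEffectiveCartier ((C.comap π).comap Q.subschemeι))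
    (πS : Q.subscheme ⟶ Y) (hπS : πS ≫ k = Q.subschemeι ≫ π) : IsBlowup πS (C.comap k) := by
  haveI : IsProper π := hπ.isProper
  haveI : IsLocallyNoetherian X' := LocallyOfFiniteType.isLocallyNoetherian π
  constructor
  · rw [← Scheme.IdealSheafData.comap_comp, hπS, Scheme.IdealSheafData.comap_comp]
    exact hE
  · intro W f hf
    have hf' : IsEffectiveCartier (C.comap (f ≫ k)) := by
      rwa [Scheme.IdealSheafData.comap_comp]
    obtain ⟨g, hg, hgu⟩ := hπ.universal (f ≫ k) hf'
    have hDg : IsEffectiveCartier ((C.comap π).comap g) := by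
      rwa [← Scheme.IdealSheafData.comap_comp, hg]
    have hprod : (C.comap π).comap g ^ μ * Q.comap g = ⊥ := by
      rw [← comap_pow, ← comap_mul, hQ, ← Scheme.IdealSheafData.comap_comp, hg, Scheme.IdealSheafData.comap_comp,
        comap_ker_self, Scheme.IdealSheafData.comap_bot]
    have hle : Q.subschemeι.ker ≤ g.ker := by
      rw [Scheme.IdealSheafData.ker_subschemeι, le_ker_iff_comap_eq_bot]
      exact (hDg.pow μ).eq_bot_of_mul_eq_bot hprod
    refine ⟨IsClosedImmersion.lift Q.subschemeι g hle, ?_, ?_⟩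
    · show IsClosedImmersion.lift Q.subschemeι g hle ≫ πS = f
      rw [← cancel_mono k, Category.assoc, hπS, IsClosedImmersion.lift_fac_assoc, hg]
    · intro g' hg'
      change g' ≫ πS = f at hg'
      rw [← cancel_mono Q.subschemeι, IsClosedImmersion.lift_fac]
      apply hgu
      show (g' ≫ Q.subschemeι) ≫ π = f ≫ k
      rw [Category.assoc, ← hπS, ← Category.assoc, hg']

end Summit.ResolutionOfSingularities.ResolutionOfSingularities.Theorems.DepthTargets

end
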